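import Mathlib
import Summits.NavierStokesRegularity.NavierStokesRegularity.Theorems.DssFarFieldSlavingBlowupTypeIDssProfileSimilarityEnstrophyCutoffBudget
import Summits.NavierStokesRegularity.NavierStokesRegularity.Theorems.LerayQuarterDissipationFiniteDissipationLiouvilleSmallDissipationGap
import HarnessLib

/-!
# Crux `FiniteDissipationLiouville` (stmt-NavierStokesRegularity-22144): the localised similarity
# enstrophy budget WITH ITS STRETCHING SLACK, and what it forces at the law-free threshold `C ≤ 1`

Theorems file of route `LerayQuarterDissipation` (lead prover g14; `--supports` the crux; file 1 of
the THRESHOLD-ONE chain `…ThresholdBudget`, `…ThresholdVortexLines`, `…ThresholdSecondDerivatives`,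
`…ThresholdOne`). Navier–Stokes regularity is NOT proved by anything here; no summit is.

The tree's T31⁗ budget (`SimilarityEnstrophy.deriv_cutoffEnstrophy_le`, route DssFarFieldSlaving)
for a Type-I ancient mild field `V` in the KNSS gauge (`‖V(t,x)‖ ≤ C/√(−t)`) reads, with
`U = lerayOrbit V`, `Ω = lerayVorticity V = curl U`, `φ_R(y) = smoothTransition(2 − ‖y‖²/R²)`,
`Z_R(s) = ∫φ_R‖Ω(s)‖²`: `Z_R' ≤ −½(1 − C²)Z_R + (L/R)∫_{B̄_{2R}}‖Ω‖²`. It DISCARDS the slack of the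
step `|⟪U, DΩ Ω⟫| ≤ C‖DΩ Ω‖`. Keeping it:

* `two_mul_integral_cutoff_stretching_le_sub_slack` — the stretching bound of T31⁗ minus the SLACK
  `σ_R(s) = 2∫φ_R (C − ‖U‖) ‖DΩ Ω‖ ≥ 0`;
* `deriv_cutoffEnstrophy_le_sub_slack` — `Z_R' ≤ −½(1 − C²)Z_R + (L/R)∫_{B̄_{2R}}‖Ω‖² − σ_R`;
* `exists_slack_lt` — **AT THE THRESHOLD `C ≤ 1`, UNDER THE LAW, THE SLACK IS SOMEWHERE SMALL**: for
  a member of `𝒟_{C,K}` with `C ≤ 1` (so `−½(1−C²)Z_R ≤ 0`, and `∫‖Ω(s)‖² ≤ M(K)` by scale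
  invariance of the law, `SmallDissipationGap.integrable_sq_norm_lerayVorticity`), for every `R ≥ 1`
  and `ε > 0` some similarity time `s` has `σ_R(s) < LM/R + ε` (otherwise `Z_R' ≤ −ε` for all `s`
  and the non-negative `Z_R` would become negative).

Downstream (`…ThresholdOne`): along such times the rescaled critical element converges (KNSS
compactness + second-derivative interpolation) to a singular member whose slice satisfies
`(1 − ‖U‖)‖DΩ Ω‖ ≡ 0`, which is impossible (`‖U‖ ≡ 1` on an open set contradicts analyticity +
decay; `DΩ Ω ≡ 0` contradicts `…ThresholdVortexLines`): NO finite-dissipation Type-I singularity has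
Type-I constant `C ≤ 1`, and by compactness none has `C ≤ 1 + ε(K)`.

HONEST FRAMING: a bookkeeping refinement of a landed identity; nothing here alone excludes anything.

References: Koch–Nadirashvili–Seregin–Šverák, arXiv:0709.3599 §4; the tree's T31⁗ files
(`…SimilarityEnstrophyCutoffBudget`, `…TimeOnlyThreshold`); Leray 1934 §20 (scaling).
-/

noncomputable section

set_option linter.dupNamespace false

namespace Summit.NavierStokesRegularity.NavierStokesRegularity.Theorems.FiniteDissipationLiouville.ThresholdOne

open MeasureTheory Set Filter Topology Metric InnerProductSpace Function Real
open scoped RealInnerProductSpace Laplacian ContDiff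
open Literature.Analysis Literature.Analysis.FluidPDE
open Summit.NavierStokesRegularity.NavierStokesRegularity.Theorems
open Summit.NavierStokesRegularity.NavierStokesRegularity.Theorems.GaussianGap
open Summit.NavierStokesRegularity.NavierStokesRegularity.Theorems.SimilarityEnstrophy

variable {C : ℝ} {V : ℝ → EuclideanSpace ℝ (Fin 3) → EuclideanSpace ℝ (Fin 3)}

/-! ### The stretching bound with its slack -/

/-- **The stretching term against the cutoff, with the slack of `‖U‖ ≤ C` kept.** With `‖U‖ ≤ C`:
`2∫φ⟪DU Ω, Ω⟫ ≤ 2∫φ‖∇Ω‖²_F + (C²/2)∫φ‖Ω‖² + 2C‖∇φ‖_∞∫_{supp φ}‖Ω‖² − 2∫φ(C − ‖U‖)‖DΩ Ω‖` (the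
T31⁗ chain `SimilarityEnstrophy.two_mul_integral_cutoff_stretching_le` verbatim, except that
`‖U‖‖DΩ Ω‖ = C‖DΩ Ω‖ − (C − ‖U‖)‖DΩ Ω‖` is not rounded up to `C‖DΩ Ω‖`). [cite: KochNadirashviliSereginSverak2009, §4 (arXiv:0709.3599 p. 8)] -/
theorem two_mul_integral_cutoff_stretching_le_sub_slack (hV : IsTypeIAncientMild C V) {c₁ : ℝ}
    (hc₁ : ∀ R : ℝ, 0 < R → ∀ y : EuclideanSpace ℝ (Fin 3),
      ‖fderiv ℝ (fun z : EuclideanSpace ℝ (Fin 3) => smoothTransition (2 - ‖z‖ ^ 2 / R ^ 2)) y‖ ≤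
        c₁ / R)
    {R : ℝ} (hR : 0 < R) (s : ℝ) :
    2 * (∫ y, smoothTransition (2 - ‖y‖ ^ 2 / R ^ 2) *
        ⟪fderiv ℝ (lerayOrbit V s) y (lerayVorticity V s y), lerayVorticity V s y⟫) ≤
      2 * (∫ y, smoothTransition (2 - ‖y‖ ^ 2 / R ^ 2) *
          frobeniusNormSq (fderiv ℝ (lerayVorticity V s) y)) +
        (C ^ 2 / 2) * (∫ y, smoothTransition (2 - ‖y‖ ^ 2 / R ^ 2) * ‖lerayVorticity V s y‖ ^ 2) +
        2 * C * (c₁ / R) *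
          (∫ y in closedBall (0 : EuclideanSpace ℝ (Fin 3)) (2 * R), ‖lerayVorticity V s y‖ ^ 2) -
        2 * (∫ y, smoothTransition (2 - ‖y‖ ^ 2 / R ^ 2) *
          ((C - ‖lerayOrbit V s y‖) *
            ‖fderiv ℝ (lerayVorticity V s) y (lerayVorticity V s y)‖)) := by
  -- adapted from `SimilarityEnstrophy.two_mul_integral_cutoff_stretching_le` (T31⁗ budget file)
  have hC : 0 ≤ C := hV.nonneg
  set φ : EuclideanSpace ℝ (Fin 3) → ℝ := fun z => smoothTransition (2 - ‖z‖ ^ 2 / R ^ 2)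
    with hφdef
  set Ω := lerayVorticity V s with hΩdef
  set U := lerayOrbit V s with hUdef
  have hφ1 : ContDiff ℝ 1 φ := contDiff_smoothTransition_cutoff (n := 1) R
  have hφc : HasCompactSupport φ := hasCompactSupport_smoothTransition_cutoff hR
  have hφ0 : ∀ y, 0 ≤ φ y := fun y => smoothTransition_cutoff_nonneg R y
  have hΩ1 : ContDiff ℝ 1 Ω := signedBudget_contDiff_lerayVorticity_slice hV s (n := 1)
  have hU1 : ContDiff ℝ 1 U := mustSqueeze_contDiff_lerayOrbit_slice hV s (n := 1)
  have hUC : ∀ y, ‖U y‖ ≤ C := fun y => norm_lerayOrbit_le_of_typeI hV s y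
  have hdivΩ : VectorCalculus.IsDivFree Ω := fun y =>
    divergence_curl_eq_zero_holds _
      ((contDiff_lerayOrbit_slice_of_typeI hV s (n := (⊤ : ℕ∞)) le_rfl).of_le (by norm_cast)) y
  -- continuity
  have hcΩ : Continuous Ω := hΩ1.continuous
  have hcU : Continuous U := hU1.continuous
  have hcDΩ : Continuous (fderiv ℝ Ω) := hΩ1.continuous_fderiv one_ne_zero
  have hcφ : Continuous φ := hφ1.continuous
  have hcDφ : Continuous (fderiv ℝ φ) := hφ1.continuous_fderiv one_ne_zero
  have hcF : Continuous fun y => frobeniusNormSq (fderiv ℝ Ω y) :=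
    continuous_frobeniusNormSq_fderiv_lerayVorticity hV s
  -- move the derivative onto `Ω`
  have hIBP := integral_mul_inner_stretching_eq hφ1 hφc hU1 hΩ1 hdivΩ
  -- (a) the main term, with slack
  have iF : Integrable fun y => φ y * frobeniusNormSq (fderiv ℝ Ω y) :=
    (hcφ.mul hcF).integrable_of_hasCompactSupport hφc.mul_right
  have iZ : Integrable fun y => φ y * ‖Ω y‖ ^ 2 :=
    (hcφ.mul (hcΩ.norm.pow 2)).integrable_of_hasCompactSupport hφc.mul_right
  have iQ : Integrable fun y => φ y * ⟪U y, fderiv ℝ Ω y (Ω y)⟫ :=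
    (hcφ.mul (hcU.inner (hcDΩ.clm_apply hcΩ))).integrable_of_hasCompactSupport hφc.mul_right
  have iS : Integrable fun y => φ y * ((C - ‖U y‖) * ‖fderiv ℝ Ω y (Ω y)‖) :=
    (hcφ.mul ((continuous_const.sub hcU.norm).mul (hcDΩ.clm_apply hcΩ).norm)).integrable_of_hasCompactSupport
      hφc.mul_right
  have hmain : -(∫ y, φ y * ⟪U y, fderiv ℝ Ω y (Ω y)⟫) ≤
      (∫ y, φ y * frobeniusNormSq (fderiv ℝ Ω y)) + (C ^ 2 / 4) * (∫ y, φ y * ‖Ω y‖ ^ 2) -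
        ∫ y, φ y * ((C - ‖U y‖) * ‖fderiv ℝ Ω y (Ω y)‖) := by
    have hRHS : (∫ y, φ y * frobeniusNormSq (fderiv ℝ Ω y)) + (C ^ 2 / 4) * (∫ y, φ y * ‖Ω y‖ ^ 2) -
        (∫ y, φ y * ((C - ‖U y‖) * ‖fderiv ℝ Ω y (Ω y)‖)) =
        ∫ y, (φ y * frobeniusNormSq (fderiv ℝ Ω y) + C ^ 2 / 4 * (φ y * ‖Ω y‖ ^ 2) -
          φ y * ((C - ‖U y‖) * ‖fderiv ℝ Ω y (Ω y)‖)) := by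
      have iZc : Integrable (fun y => C ^ 2 / 4 * (φ y * ‖Ω y‖ ^ 2)) := iZ.const_mul _
      have iFZ : Integrable (fun y => φ y * frobeniusNormSq (fderiv ℝ Ω y) +
          C ^ 2 / 4 * (φ y * ‖Ω y‖ ^ 2)) := iF.add iZc
      rw [integral_sub iFZ iS, integral_add iF iZc, integral_const_mul]
    have iAll : Integrable (fun y => φ y * frobeniusNormSq (fderiv ℝ Ω y) +
        C ^ 2 / 4 * (φ y * ‖Ω y‖ ^ 2) - φ y * ((C - ‖U y‖) * ‖fderiv ℝ Ω y (Ω y)‖)) :=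
      (iF.add (iZ.const_mul _)).sub iS
    have iQn : Integrable (fun y => -(φ y * ⟪U y, fderiv ℝ Ω y (Ω y)⟫)) := iQ.neg
    rw [hRHS, ← integral_neg]
    refine integral_mono iQn iAll fun y => ?_
    dsimp only
    have hop := sq_opNorm_le_frobeniusNormSq (fderiv ℝ Ω y)
    set a := ‖fderiv ℝ Ω y‖ with ha
    set b := ‖Ω y‖ with hb
    have hab : ‖fderiv ℝ Ω y (Ω y)‖ ≤ a * b := ContinuousLinearMap.le_opNorm _ _
    have h1 : -(φ y * ⟪U y, fderiv ℝ Ω y (Ω y)⟫) ≤ φ y * (‖U y‖ * ‖fderiv ℝ Ω y (Ω y)‖) := by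
      rw [← mul_neg]
      refine mul_le_mul_of_nonneg_left ?_ (hφ0 y)
      calc -⟪U y, fderiv ℝ Ω y (Ω y)⟫ ≤ ‖⟪U y, fderiv ℝ Ω y (Ω y)⟫‖ := by
            rw [Real.norm_eq_abs]; exact neg_le_abs _
        _ ≤ ‖U y‖ * ‖fderiv ℝ Ω y (Ω y)‖ := norm_inner_le_norm _ _
    have h2 : C * (a * b) ≤ a ^ 2 + C ^ 2 / 4 * b ^ 2 := by
      nlinarith [sq_nonneg (a - C * b / 2)]
    have hsplit : ‖U y‖ * ‖fderiv ℝ Ω y (Ω y)‖ =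
        C * ‖fderiv ℝ Ω y (Ω y)‖ - (C - ‖U y‖) * ‖fderiv ℝ Ω y (Ω y)‖ := by ring
    have h3 : C * ‖fderiv ℝ Ω y (Ω y)‖ ≤ C * (a * b) := mul_le_mul_of_nonneg_left hab hC
    have h4 : φ y * (‖U y‖ * ‖fderiv ℝ Ω y (Ω y)‖) ≤
        φ y * (frobeniusNormSq (fderiv ℝ Ω y) + C ^ 2 / 4 * b ^ 2 -
          (C - ‖U y‖) * ‖fderiv ℝ Ω y (Ω y)‖) := by
      refine mul_le_mul_of_nonneg_left ?_ (hφ0 y)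
      rw [hsplit]
      linarith
    have e5 : φ y * (frobeniusNormSq (fderiv ℝ Ω y) + C ^ 2 / 4 * b ^ 2 -
          (C - ‖U y‖) * ‖fderiv ℝ Ω y (Ω y)‖) =
        φ y * frobeniusNormSq (fderiv ℝ Ω y) + C ^ 2 / 4 * (φ y * b ^ 2) -
          φ y * ((C - ‖U y‖) * ‖fderiv ℝ Ω y (Ω y)‖) := by ring
    linarith
  -- (b) the collar term
  have hcollar : |∫ y, fderiv ℝ φ y (Ω y) * ⟪U y, Ω y⟫| ≤
      C * (c₁ / R) * ∫ y in closedBall (0 : EuclideanSpace ℝ (Fin 3)) (2 * R), ‖Ω y‖ ^ 2 := by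
    refine abs_integral_le_of_weight_sq hcΩ (w := fun y => C * ‖fderiv ℝ φ y‖)
      (continuous_const.mul hcDφ.norm) (fun y hy => ?_) (fun y _ => ?_) (fun y => ?_)
    · show C * ‖fderiv ℝ φ y‖ = 0
      rw [hφdef, signedBudget_fderiv_cutoff_eq_zero hR hy, norm_zero, mul_zero]
    · show C * ‖fderiv ℝ φ y‖ ≤ C * (c₁ / R)
      exact mul_le_mul_of_nonneg_left (hc₁ R hR y) hC
    · rw [abs_mul]
      have e1 : |fderiv ℝ φ y (Ω y)| ≤ ‖fderiv ℝ φ y‖ * ‖Ω y‖ := by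
        rw [← Real.norm_eq_abs]; exact ContinuousLinearMap.le_opNorm _ _
      have e2 : |⟪U y, Ω y⟫| ≤ C * ‖Ω y‖ := by
        rw [← Real.norm_eq_abs]
        exact (norm_inner_le_norm _ _).trans (mul_le_mul_of_nonneg_right (hUC y) (norm_nonneg _))
      calc |fderiv ℝ φ y (Ω y)| * |⟪U y, Ω y⟫| ≤ (‖fderiv ℝ φ y‖ * ‖Ω y‖) * (C * ‖Ω y‖) :=
            mul_le_mul e1 e2 (abs_nonneg _) (by positivity)
        _ = C * ‖fderiv ℝ φ y‖ * ‖Ω y‖ ^ 2 := by ring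
  have hcollar' : -(∫ y, fderiv ℝ φ y (Ω y) * ⟪U y, Ω y⟫) ≤
      C * (c₁ / R) * ∫ y in closedBall (0 : EuclideanSpace ℝ (Fin 3)) (2 * R), ‖Ω y‖ ^ 2 :=
    (neg_le_abs _).trans hcollar
  rw [hIBP]
  linarith

/-! ### The budget with its slack -/

/-- **The localised similarity-enstrophy budget with the stretching slack kept.** For a KNSS-gauge
Type-I field `V` with constant `C` there is `L ≥ 0` with, for every `R ≥ 1` and every `s`:
`Z_R'(s) ≤ −½(1 − C²)Z_R(s) + (L/R)∫_{B̄_{2R}}‖Ω(s)‖² − 2∫φ_R(C − ‖U(s)‖)‖DΩ(s) Ω(s)‖`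
(`SimilarityEnstrophy.deriv_cutoffEnstrophy_le` with `two_mul_integral_cutoff_stretching_le_sub_slack`
in place of its stretching bound). [cite: KochNadirashviliSereginSverak2009, §4 (arXiv:0709.3599 p. 8)] -/
theorem deriv_cutoffEnstrophy_le_sub_slack (hV : IsTypeIAncientMild C V) :
    ∃ L : ℝ, 0 ≤ L ∧ ∀ R : ℝ, 1 ≤ R → ∀ s : ℝ,
      deriv (fun σ => ∫ y, smoothTransition (2 - ‖y‖ ^ 2 / R ^ 2) * ‖lerayVorticity V σ y‖ ^ 2) s ≤
        -((1 / 2) * (1 - C ^ 2)) *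
            (∫ y, smoothTransition (2 - ‖y‖ ^ 2 / R ^ 2) * ‖lerayVorticity V s y‖ ^ 2) +
          L / R * (∫ y in closedBall (0 : EuclideanSpace ℝ (Fin 3)) (2 * R),
            ‖lerayVorticity V s y‖ ^ 2) -
          2 * (∫ y, smoothTransition (2 - ‖y‖ ^ 2 / R ^ 2) *
            ((C - ‖lerayOrbit V s y‖) *
              ‖fderiv ℝ (lerayVorticity V s) y (lerayVorticity V s y)‖)) := by
  -- adapted from `SimilarityEnstrophy.deriv_cutoffEnstrophy_le` (T31⁗ budget file)
  obtain ⟨c₁, hc₁0, hc₁⟩ :=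
    exists_norm_fderiv_smoothTransition_cutoff_le (E := EuclideanSpace ℝ (Fin 3))
  obtain ⟨c₂, hc₂0, hc₂⟩ :=
    exists_abs_laplacian_smoothTransition_cutoff_le (E := EuclideanSpace ℝ (Fin 3))
  have hC : 0 ≤ C := hV.nonneg
  refine ⟨3 * C * c₁ + c₂, by positivity, fun R hR1 s => ?_⟩
  have hR : 0 < R := lt_of_lt_of_le one_pos hR1
  rw [signedBudget_deriv_cutoffEnstrophy_eq hV hR s]
  set φ : EuclideanSpace ℝ (Fin 3) → ℝ := fun z => smoothTransition (2 - ‖z‖ ^ 2 / R ^ 2)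
    with hφdef
  set Ω := lerayVorticity V s with hΩdef
  set U := lerayOrbit V s with hUdef
  set I : ℝ := ∫ y in closedBall (0 : EuclideanSpace ℝ (Fin 3)) (2 * R), ‖Ω y‖ ^ 2 with hIdef
  have hI0 : 0 ≤ I := integral_nonneg fun y => sq_nonneg _
  have hφ1 : ContDiff ℝ 1 φ := contDiff_smoothTransition_cutoff (n := 1) R
  have hφ2 : ContDiff ℝ 2 φ := contDiff_smoothTransition_cutoff (n := 2) R
  have hcDφ : Continuous (fderiv ℝ φ) := hφ1.continuous_fderiv one_ne_zero
  have hΩ1 : ContDiff ℝ 1 Ω := signedBudget_contDiff_lerayVorticity_slice hV s (n := 1)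
  have hcΩ : Continuous Ω := hΩ1.continuous
  have hUC : ∀ y, ‖U y‖ ≤ C := fun y => norm_lerayOrbit_le_of_typeI hV s y
  -- (1) drift flux `≤ 0`
  have hD : (∫ y, fderiv ℝ φ y y * ‖Ω y‖ ^ 2) ≤ 0 := signedBudget_drift_flux_nonpos V R s
  -- (2) transport flux
  have hT : |∫ y, fderiv ℝ φ y (U y) * ‖Ω y‖ ^ 2| ≤ C * (c₁ / R) * I := by
    refine abs_integral_le_of_weight_sq hcΩ (w := fun y => C * ‖fderiv ℝ φ y‖)
      (continuous_const.mul hcDφ.norm) (fun y hy => ?_) (fun y _ => ?_) (fun y => ?_)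
    · show C * ‖fderiv ℝ φ y‖ = 0
      rw [hφdef, signedBudget_fderiv_cutoff_eq_zero hR hy, norm_zero, mul_zero]
    · show C * ‖fderiv ℝ φ y‖ ≤ C * (c₁ / R)
      exact mul_le_mul_of_nonneg_left (hc₁ R hR y) hC
    · rw [abs_mul, abs_of_nonneg (sq_nonneg ‖Ω y‖)]
      have e1 : |fderiv ℝ φ y (U y)| ≤ ‖fderiv ℝ φ y‖ * C := by
        rw [← Real.norm_eq_abs]
        exact (ContinuousLinearMap.le_opNorm _ _).trans
          (mul_le_mul_of_nonneg_left (hUC y) (norm_nonneg _))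
      calc |fderiv ℝ φ y (U y)| * ‖Ω y‖ ^ 2 ≤ (‖fderiv ℝ φ y‖ * C) * ‖Ω y‖ ^ 2 :=
            mul_le_mul_of_nonneg_right e1 (sq_nonneg _)
        _ = C * ‖fderiv ℝ φ y‖ * ‖Ω y‖ ^ 2 := by ring
  -- (3) viscous flux
  have hVisc : |∫ y, ‖Ω y‖ ^ 2 * (Δ φ) y| ≤ (c₂ / R ^ 2) * I := by
    refine abs_integral_le_of_weight_sq hcΩ (w := fun y => |(Δ φ) y|)
      (continuous_laplacian hφ2).abs (fun y hy => ?_) (fun y _ => hc₂ R hR y) (fun y => ?_)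
    · show |(Δ φ) y| = 0
      rw [hφdef, signedBudget_laplacian_cutoff_eq_zero hR hy, abs_zero]
    · rw [abs_mul, abs_of_nonneg (sq_nonneg ‖Ω y‖), mul_comm]
  have hR2 : c₂ / R ^ 2 ≤ c₂ / R := by
    rw [div_le_div_iff₀ (by positivity) hR]
    have : R ≤ R ^ 2 := by nlinarith
    exact mul_le_mul_of_nonneg_left this hc₂0
  -- (4) stretching, with slack
  have hS := two_mul_integral_cutoff_stretching_le_sub_slack hV hc₁ hR s
  -- assemble
  have hT' := (le_abs_self _).trans hT
  have hVisc' := ((le_abs_self _).trans hVisc).trans (mul_le_mul_of_nonneg_right hR2 hI0)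
  have e : (3 * C * c₁ + c₂) / R * I = C * (c₁ / R) * I + 2 * C * (c₁ / R) * I + c₂ / R * I := by
    ring
  rw [e]
  nlinarith [hD, hT', hVisc', hS]

/-! ### At the threshold `C ≤ 1`, under the law, the slack is somewhere small -/

/-- **The slack is non-negative**: `0 ≤ 2∫φ_R(C − ‖U‖)‖DΩ Ω‖` (`‖U‖ ≤ C`, `φ_R ≥ 0`). -/
theorem slack_nonneg (hV : IsTypeIAncientMild C V) (R s : ℝ) :
    0 ≤ 2 * (∫ y, smoothTransition (2 - ‖y‖ ^ 2 / R ^ 2) *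
      ((C - ‖lerayOrbit V s y‖) * ‖fderiv ℝ (lerayVorticity V s) y (lerayVorticity V s y)‖)) := by
  refine mul_nonneg two_pos.le (integral_nonneg fun y => ?_)
  exact mul_nonneg (smoothTransition_cutoff_nonneg R y)
    (mul_nonneg (sub_nonneg.2 (norm_lerayOrbit_le_of_typeI hV s y)) (norm_nonneg _))

/-- **AT THE THRESHOLD `C ≤ 1`, UNDER THE DISSIPATION LAW, THE SLACK IS SOMEWHERE SMALL.** Let
`V ∈ 𝒟_{C,K}` with `C ≤ 1`. There are `L, M ≥ 0` such that for every `R ≥ 1` and every `ε > 0`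
some similarity time `s` has `2∫φ_R(C − ‖U(s)‖)‖DΩ(s) Ω(s)‖ < LM/R + ε`. Indeed
`∫_{B̄_{2R}}‖Ω(s)‖² ≤ ∫‖Ω(s)‖² ≤ M` for all `s` by the scale invariance of the law
(`SmallDissipationGap.integrable_sq_norm_lerayVorticity`), so `deriv_cutoffEnstrophy_le_sub_slack`
with `−½(1 − C²)Z_R ≤ 0` gives `Z_R' ≤ LM/R − slack`; if the slack were `≥ LM/R + ε` at all times,
`Z_R` would decrease at rate `ε` forever and become negative. [cite: KochNadirashviliSereginSverak2009, §4 (arXiv:0709.3599 p. 8)] -/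
theorem exists_slack_lt (hV : IsTypeIAncientMild C V) (hC1 : C ≤ 1) {K : ℝ}
    (hlaw : ∀ t : ℝ, t < 0 → ∫⁻ x, ‖fderiv ℝ (V t) x‖ₑ ^ 2 ≤ ENNReal.ofReal (K / Real.sqrt (-t))) :
    ∃ L M : ℝ, 0 ≤ L ∧ 0 ≤ M ∧ ∀ R : ℝ, 1 ≤ R → ∀ ε : ℝ, 0 < ε → ∃ s : ℝ,
      2 * (∫ y, smoothTransition (2 - ‖y‖ ^ 2 / R ^ 2) *
        ((C - ‖lerayOrbit V s y‖) * ‖fderiv ℝ (lerayVorticity V s) y (lerayVorticity V s y)‖)) <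
        L * M / R + ε := by
  obtain ⟨L, hL0, hbudget⟩ := deriv_cutoffEnstrophy_le_sub_slack hV
  -- the law in similarity variables: `∫‖Ω(s)‖² ≤ M`
  obtain ⟨M, hM0, hM⟩ : ∃ M : ℝ, 0 ≤ M ∧ ∀ s : ℝ,
      Integrable (fun y => ‖lerayVorticity V s y‖ ^ 2) ∧ ∫ y, ‖lerayVorticity V s y‖ ^ 2 ≤ M := by
    refine ⟨_, ?_, fun s => SmallDissipationGap.integrable_sq_norm_lerayVorticity hV hlaw s⟩
    have h := (SmallDissipationGap.integrable_sq_norm_lerayVorticity hV hlaw 0).2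
    exact (integral_nonneg fun y => sq_nonneg _).trans h
  refine ⟨L, M, hL0, hM0, fun R hR1 ε hε => ?_⟩
  have hR : 0 < R := lt_of_lt_of_le one_pos hR1
  by_contra hcon
  push Not at hcon
  -- the cut-off enstrophy and its derivative bound `≤ −ε`
  set Z : ℝ → ℝ := fun σ => ∫ y, smoothTransition (2 - ‖y‖ ^ 2 / R ^ 2) * ‖lerayVorticity V σ y‖ ^ 2
    with hZdef
  have hZd : ∀ s, DifferentiableAt ℝ Z s := fun s =>
    (signedBudget_hasDerivAt_cutoffEnstrophy hV hR s).differentiableAt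
  have hZ0 : ∀ s, 0 ≤ Z s := fun s =>
    integral_nonneg fun y => mul_nonneg (smoothTransition_cutoff_nonneg R y) (sq_nonneg _)
  have hI : ∀ s, (∫ y in closedBall (0 : EuclideanSpace ℝ (Fin 3)) (2 * R), ‖lerayVorticity V s y‖ ^ 2)
      ≤ M := fun s =>
    (setIntegral_le_integral (hM s).1 (Eventually.of_forall fun y => sq_nonneg _)).trans (hM s).2
  have hZ' : ∀ s, deriv Z s ≤ -ε := by
    intro s
    have hb := hbudget R hR1 s
    have hslack := hcon s
    have hfirst : -((1 / 2) * (1 - C ^ 2)) *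
        (∫ y, smoothTransition (2 - ‖y‖ ^ 2 / R ^ 2) * ‖lerayVorticity V s y‖ ^ 2) ≤ 0 := by
      have h1 : 0 ≤ (1 / 2) * (1 - C ^ 2) := by nlinarith [hV.nonneg]
      have := hZ0 s
      simp only [hZdef] at this
      nlinarith
    have hsecond : L / R * (∫ y in closedBall (0 : EuclideanSpace ℝ (Fin 3)) (2 * R),
        ‖lerayVorticity V s y‖ ^ 2) ≤ L * M / R := by
      rw [show L * M / R = L / R * M by ring]
      exact mul_le_mul_of_nonneg_left (hI s) (div_nonneg hL0 hR.le)
    show deriv Z s ≤ -ε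
    simp only [hZdef]
    linarith
  -- `Z` decreases at rate `ε` forever: contradiction with `Z ≥ 0`
  have hdiff : Differentiable ℝ Z := hZd
  set s₁ : ℝ := Z 0 / ε + 1 with hs₁
  have hs₁pos : 0 < s₁ := by
    have : 0 ≤ Z 0 / ε := div_nonneg (hZ0 0) hε.le
    linarith
  have hmvt : Z s₁ - Z 0 ≤ -ε * (s₁ - 0) :=
    image_sub_le_mul_sub_of_deriv_le hdiff hZ' hs₁pos.le
  have hneg : Z s₁ < 0 := by
    have e : -ε * (s₁ - 0) = -(Z 0) - ε := by
      rw [hs₁]; field_simp; ring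
    rw [e] at hmvt
    linarith
  exact absurd (hZ0 s₁) (not_le.2 hneg)

end Summit.NavierStokesRegularity.NavierStokesRegularity.Theorems.FiniteDissipationLiouville.ThresholdOne

end
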